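import Summits.QuantumFields.BalabanUV.Beta.D1BFx.RoadEndBFxDictPointwiseS
import Summits.QuantumFields.BalabanUV.Beta.AxialDressingRootedBmHessian
import Summits.QuantumFields.BalabanUV.Beta.RelInvBorderedHessian

/-!
# Road «BF-x» — THE ROAD's OWN ONE-SHOT WITNESS (PART 20a): a composite jet-data family `JcW` whose typed one-shot kernel `TshotOf Lc JcW m`
# IS the road's (K)-slot kernel `hessKer (G₀ n) (vertexOfK (G₀ n) n (S n)) (vertex2OfK (G₀ n) n (S₂ n))` EXACTLY, `n = Lc^m ≥ 2`
# (unit `b2b-balaban-beta-d1-p2`, gen 21 — road OWNER; serves PART 20 «THE JUNCTIONS WITH A (J1) REST» and the (J1) defect's rows)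

HONEST DEPENDENCY (page 1, mandatory): continuum YM on T⁴ ⇐ BetaPertH ∧ nine spine estimates (0/9 proved); BetaPertH ⇐ (D1) ∧ (D4) ∧ CAP+tail;
G-an2-4 gates asym, D1 and NE2/3/4.  HONEST FRAMING (cell contract, verbatim): «discharging `BetaPertH` makes Bałaban's UV stability UNCONDITIONAL — a real
constructive-QFT result; it is NOT the continuum limit and NOT the Clay problem.»  THIS FILE: [folklore] plumbing BY NAME over tree objects; proves NO estimate
of Bałaban's; the witness is NOT the one-shot literal of record (`CombOneShotJets.JcOf`, whose leg is `GcombSh n 0` — an2 R-D1-g42-1 (a)); 0 root-level binders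
of row D1 discharged; (K) NOT closed; NOT D1, NOT BetaPertH, NOT continuum, NOT Clay.

WHAT.  For the END's literal sockets `hS : ∀ n ≥ 2, LocStencil (S n) (Cs n) (δS n)`, `hS₂ : ∀ n ≥ 2, ∀ κ u κ′ u′, BiLoc (S₂ n κ u κ′ u′) u u (Ck n·e^{−δ₂ n·|u′−u|₁}) (δ₂ n)`
(constants `hCs hδS hCk hδ₂`) and per-scale roots `hr : ∀ n ≥ 2, r n ∈ box 4 n`:
* §1 **`exists_jetData_TOf_eq_road`** (one scale `n ≥ 2`): `∃ J : JetData 3 n, TOf J = hessKer (G₀ n) (vertexOfK (G₀ n) n (S n)) (vertex2OfK (G₀ n) n (S₂ n))`,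
  `G₀ n = coDressKBmAt (toSite (r n)) n (KInvStep n 0)` — the block-mean dressing `AxialDressingRooted.dressBmAt (hr n)` of `⟨S n, vertex2OfK (G₀ n) n (S₂ n)⟩` (letters:
  `decays_coDressKBmAt_KInvStep` + `SecondOrderResponse.vertexFamily₂_vertex2OfK` at the common rate `min δG (δ₂ n)`); kernel identity = `TOf` unfolded +
  `OneStepKernelFamily.vertexOfK_KInv` + `BorderedHessian.KInvStep_zero_eq` + an2's `AxialDressingRooted.hessKer_dressBmAt`.
* §2 **`exists_roadWitness`**: `∃ JcW : ∀ m, JetData 3 (Lc^m), ∀ m ≥ 1, TshotOf Lc JcW m = hessKer (G₀ (Lc^m)) …` (the witnesses `choose`n on the scales; below scale 2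
  any datum — here the zero-free choice `JcW m := if 2 ≤ Lc^m then … else (a fixed default)` is avoided by quantifying a default family `Jd`).
* §3 **`absMoment₂_road_kernel`**: every channel of the road's kernel at every scale `Lc^m`, `m ≥ 1`, has absolutely summable (1.22) second moments
  (`OneStepKernelFamily.absMoment₂_TshotOf` at the witness) — the `AbsMoment₂` half of the (J1) defect's rows, free.
ABSOLUTE RULE (cell charter, verbatim): «No internally-minted statement may enter as a cited fact. Every hypothesis is either kernel-proved in this package or a
verbatim quotation of a PUBLISHED theorem with page reference. The manuscript(s) under audit are NOT citable for their own disputed steps — they are the thing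
under adjudication; programme-internal (2001/route/tribunal) claims are never citable.»  No `def`, no `def … : Prop`, nothing cited as mathematics; 0 sorry.
-/

noncomputable section
open Literature.MathematicalPhysics.QuantumFieldTheory.Balaban1983to89
open Literature.MathematicalPhysics.QuantumFieldTheory.Balaban1983to89.Beta
open B12Sec2to5 (l1 l1_nonneg)
open ExpKernelCalculus (MKer BiLoc Decays hessKer Site)
open OneStepResolventKernel (JetData KInv Fib LocStencil TOf vertexOf decays_mono biLoc_mono)
open OneStepKernelFamily (KInvStep vertexOfK TshotOf decays_KInvStep vertexOfK_KInv absMoment₂_TshotOf)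
open SecondOrderResponse (vertex2OfK vertexFamily₂_vertex2OfK cBi cBi_nonneg)
open BalabanCompositeJets (LocStencil₂)
open BalabanStepJets (locStencil_mono vertexFamily₂_mono)
open DecimatedMomentSummable (AbsMoment₂)
open AffineAveraging (box toSite)
open Summit.QuantumFields.BalabanUV.Beta.AxialDressingRooted (coDressKBmAt dressBmAt hessKer_dressBmAt decays_coDressKBmAt_KInvStep)
open Summit.QuantumFields.BalabanUV.Beta.BorderedHessian (KInvStep_zero_eq)
open Summit.QuantumFields.BalabanUV.Beta.D1BFx.RoadEndBFxDictPointwiseS (two_le_pow_scale)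

namespace Summit.QuantumFields.BalabanUV.Beta.D1BFx.RoadOneShotWitness

/-! ## §1 One scale: a jet datum whose typed kernel is the road's kernel -/

section OneScale

variable (n : ℕ) [NeZero n] {r : Fin 4 → ℕ}
  {S : Fin 4 → (Fin 4 → ℤ) → MKer 4 (Fib 3)} {Cs δS : ℝ}
  {S₂ : Fin 4 → (Fin 4 → ℤ) → Fin 4 → (Fin 4 → ℤ) → MKer 4 (Fib 3)} {Ck δ₂ : ℝ}

/-- [folklore] **THE DRESSED-KERNEL IDENTITY AT `K := KInvStep n 0 = KInv n`**: for ANY undressed datum `J₀`, the typed kernel of its block-mean dressing at root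
`r ∈ box 4 n` is `hessKer (G₀ n) (vertexOfK (G₀ n) n J₀.S) J₀.W` (an2's `hessKer_dressBmAt`; `TOf` unfolded, `vertexOfK_KInv`, `KInvStep_zero_eq`). -/
theorem TOf_dressBmAt_eq (hr : r ∈ box (3 + 1) n) (J₀ : JetData 3 n) :
    TOf (N := n) (dressBmAt hr J₀) = hessKer (coDressKBmAt (toSite r) n (KInvStep (d := 3) n 0))
      (vertexOfK (coDressKBmAt (toSite r) n (KInvStep (d := 3) n 0)) n J₀.S) J₀.W := by
  have hv : vertexOf (N := n) (dressBmAt hr J₀).S = vertexOfK (KInvStep (d := 3) n 0) n (dressBmAt hr J₀).S := by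
    funext μ' y
    rw [KInvStep_zero_eq, vertexOfK_KInv]
  have hK : (KInv (N := n) (d := 3)) = KInvStep (d := 3) n 0 := KInvStep_zero_eq.symm
  show hessKer (KInv (N := n) (d := 3)) (vertexOf (N := n) (dressBmAt hr J₀).S) (dressBmAt hr J₀).W = _
  rw [hv, hK, hessKer_dressBmAt hr (decays_KInvStep (d := 3) (Lc := n) 0) J₀]

/-- [folklore] **ONE SCALE: A JET DATUM WHOSE TYPED KERNEL IS THE ROAD's KERNEL.**  Under the literal's sockets at scale `n` (`LocStencil (S) Cs δS`, the
pair-stencil bi-localisation with constants `Ck, δ₂`) and a root `r ∈ box 4 n`: `∃ J : JetData 3 n, TOf J = hessKer (G₀ n) (vertexOfK (G₀ n) n S) (vertex2OfK (G₀ n) n S₂)`. -/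
theorem exists_jetData_TOf_eq_road (hr : r ∈ box (3 + 1) n) (hS : LocStencil S Cs δS) (hCs : 0 ≤ Cs) (hδS : 0 < δS)
    (hS₂ : ∀ κ u κ' u', BiLoc (S₂ κ u κ' u') u u (Ck * Real.exp (-δ₂ * l1 (u' - u))) δ₂) (hCk : 0 ≤ Ck) (hδ₂ : 0 < δ₂) :
    ∃ J : JetData 3 n, TOf (N := n) J = hessKer (coDressKBmAt (toSite r) n (KInvStep (d := 3) n 0))
      (vertexOfK (coDressKBmAt (toSite r) n (KInvStep (d := 3) n 0)) n S)
      (vertex2OfK (coDressKBmAt (toSite r) n (KInvStep (d := 3) n 0)) n S₂) := by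
  obtain ⟨δG, CG, hδG, hCG, hGd⟩ := decays_coDressKBmAt_KInvStep (d := 3) hr 0
  have hm₀ : 0 < min δG δ₂ := lt_min hδG hδ₂
  have hG' : Decays (coDressKBmAt (toSite r) n (KInvStep (d := 3) n 0)) CG (min δG δ₂) := decays_mono hGd hCG le_rfl (min_le_left _ _)
  have hS₂' : LocStencil₂ S₂ Ck (min δG δ₂) := by
    intro κ u κ' u'
    have h1 : BiLoc (S₂ κ u κ' u') u u (Ck * Real.exp (-(min δG δ₂) * l1 (u' - u))) δ₂ := fun x y c b => by
      refine (hS₂ κ u κ' u' x y c b).trans (mul_le_mul_of_nonneg_right ?_ (Real.exp_pos _).le)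
      exact mul_le_mul_of_nonneg_left (Real.exp_le_exp.2 (by nlinarith [l1_nonneg (u' - u), min_le_right δG δ₂])) hCk
    exact biLoc_mono h1 (by positivity) (min_le_right _ _)
  have hW := vertexFamily₂_vertex2OfK (N := n) hG' hCG hS₂' hm₀
  exact ⟨dressBmAt hr
    { S := S
      W := vertex2OfK (coDressKBmAt (toSite r) n (KInvStep (d := 3) n 0)) n S₂
      Cs := Cs
      Cw := cBi 3 CG Ck (min δG δ₂)
      δ := min δS (min δG δ₂ / 8)
      δ_pos := lt_min hδS (by positivity)
      loc := locStencil_mono hS hCs (min_le_left _ _)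
      loc₂ := vertexFamily₂_mono hW (cBi_nonneg hCG hCk hm₀) (min_le_right _ _) }, TOf_dressBmAt_eq n hr _⟩

end OneScale

/-! ## §2 The witness family on the scales and the `AbsMoment₂` rows of the road's kernel -/

section Scales

variable {Lc : ℕ} [NeZero Lc] {r : ℕ → Fin 4 → ℕ}
  {S : ℕ → Fin 4 → (Fin 4 → ℤ) → MKer 4 (Fib 3)} {Cs δS : ℕ → ℝ}
  {S₂ : ℕ → Fin 4 → (Fin 4 → ℤ) → Fin 4 → (Fin 4 → ℤ) → MKer 4 (Fib 3)} {Ck δ₂ : ℕ → ℝ}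

/-- [folklore] **THE ROAD's OWN ONE-SHOT WITNESS.**  Under the END's literal sockets (all scales `n ≥ 2`) and per-scale roots, and given ANY default family `Jd`
(read below scale 2 only, i.e. never at `m ≥ 1` when `Lc ≥ 2`): `∃ JcW : ∀ m, JetData 3 (Lc^m)`, `∀ m ≥ 1`,
`TshotOf Lc JcW m = hessKer (G₀ (Lc^m)) (vertexOfK (G₀ (Lc^m)) (Lc^m) (S (Lc^m))) (vertex2OfK (G₀ (Lc^m)) (Lc^m) (S₂ (Lc^m)))`. -/
theorem exists_roadWitness (hL : 2 ≤ Lc) (hr : ∀ n : ℕ, 2 ≤ n → ∀ [NeZero n], r n ∈ box (3 + 1) n)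
    (hS : ∀ n : ℕ, 2 ≤ n → LocStencil (S n) (Cs n) (δS n)) (hCs : ∀ n, 0 ≤ Cs n) (hδS : ∀ n, 0 < δS n)
    (hS₂ : ∀ n : ℕ, 2 ≤ n → ∀ κ u κ' u', BiLoc (S₂ n κ u κ' u') u u (Ck n * Real.exp (-δ₂ n * l1 (u' - u))) (δ₂ n))
    (hCk : ∀ n, 0 ≤ Ck n) (hδ₂ : ∀ n, 0 < δ₂ n) (Jd : ∀ m : ℕ, JetData 3 (Lc ^ m)) :
    ∃ JcW : ∀ m : ℕ, JetData 3 (Lc ^ m), ∀ m : ℕ, 1 ≤ m →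
      TshotOf Lc JcW m = hessKer (coDressKBmAt (toSite (r (Lc ^ m))) (Lc ^ m) (KInvStep (d := 3) (Lc ^ m) 0))
        (vertexOfK (coDressKBmAt (toSite (r (Lc ^ m))) (Lc ^ m) (KInvStep (d := 3) (Lc ^ m) 0)) (Lc ^ m) (S (Lc ^ m)))
        (vertex2OfK (coDressKBmAt (toSite (r (Lc ^ m))) (Lc ^ m) (KInvStep (d := 3) (Lc ^ m) 0)) (Lc ^ m) (S₂ (Lc ^ m))) := by
  have key : ∀ (n : ℕ) (_ : NeZero n), 2 ≤ n → ∃ J : JetData 3 n, TOf (N := n) J =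
      hessKer (coDressKBmAt (toSite (r n)) n (KInvStep (d := 3) n 0))
        (vertexOfK (coDressKBmAt (toSite (r n)) n (KInvStep (d := 3) n 0)) n (S n))
        (vertex2OfK (coDressKBmAt (toSite (r n)) n (KInvStep (d := 3) n 0)) n (S₂ n)) :=
    fun n _ hn => exists_jetData_TOf_eq_road n (hr n hn) (hS n hn) (hCs n) (hδS n) (hS₂ n hn) (hCk n) (hδ₂ n)
  choose JW hJW using key
  have h2 : ∀ m : ℕ, 1 ≤ m → 2 ≤ Lc ^ m := fun m hm => two_le_pow_scale hL hm
  refine ⟨fun m => if h : 2 ≤ Lc ^ m then JW (Lc ^ m) inferInstance h else Jd m, fun m hm => ?_⟩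
  show TOf (N := Lc ^ m) (if h : 2 ≤ Lc ^ m then JW (Lc ^ m) inferInstance h else Jd m) = _
  rw [dif_pos (h2 m hm)]
  exact hJW (Lc ^ m) inferInstance (h2 m hm)

/-- [folklore] **THE ROAD's KERNEL HAS ABSOLUTELY SUMMABLE (1.22) SECOND MOMENTS IN EVERY CHANNEL AT EVERY SCALE `Lc^m`, `m ≥ 1`** — read off the witness
(`OneStepKernelFamily.absMoment₂_TshotOf`); the `AbsMoment₂` half of the (J1) defect's rows. -/
theorem absMoment₂_road_kernel (hL : 2 ≤ Lc) (hr : ∀ n : ℕ, 2 ≤ n → ∀ [NeZero n], r n ∈ box (3 + 1) n)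
    (hS : ∀ n : ℕ, 2 ≤ n → LocStencil (S n) (Cs n) (δS n)) (hCs : ∀ n, 0 ≤ Cs n) (hδS : ∀ n, 0 < δS n)
    (hS₂ : ∀ n : ℕ, 2 ≤ n → ∀ κ u κ' u', BiLoc (S₂ n κ u κ' u') u u (Ck n * Real.exp (-δ₂ n * l1 (u' - u))) (δ₂ n))
    (hCk : ∀ n, 0 ≤ Ck n) (hδ₂ : ∀ n, 0 < δ₂ n) (Jd : ∀ m : ℕ, JetData 3 (Lc ^ m)) (m : ℕ) (hm : 1 ≤ m) (c e : Fin 4) :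
    AbsMoment₂ (hessKer (coDressKBmAt (toSite (r (Lc ^ m))) (Lc ^ m) (KInvStep (d := 3) (Lc ^ m) 0))
        (vertexOfK (coDressKBmAt (toSite (r (Lc ^ m))) (Lc ^ m) (KInvStep (d := 3) (Lc ^ m) 0)) (Lc ^ m) (S (Lc ^ m)))
        (vertex2OfK (coDressKBmAt (toSite (r (Lc ^ m))) (Lc ^ m) (KInvStep (d := 3) (Lc ^ m) 0)) (Lc ^ m) (S₂ (Lc ^ m))) c e) := by
  obtain ⟨JcW, hJcW⟩ := exists_roadWitness hL hr hS hCs hδS hS₂ hCk hδ₂ Jd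
  rw [← hJcW m hm]
  exact absMoment₂_TshotOf JcW m c e

end Scales

end Summit.QuantumFields.BalabanUV.Beta.D1BFx.RoadOneShotWitness

end
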